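import Literature.MathematicalPhysics.QuantumManyBody.TorusFockSectorDictionary
import Literature.MathematicalPhysics.QuantumManyBody.PeriodicBoseGasMomentumSector
import Literature.MathematicalPhysics.QuantumManyBody.PeriodicFormDomain
import HarnessLib

/-!
# Pair-correlation toolkit on the `N`-particle torus (negative-side support for crux `PuffFloor`, stmt-AtomisticToContinuum-11785)

Route `BECConjugateDomination`, crux `PuffFloor` (the linear anti-hyperuniformity floor
`S_m ≥ |k|/√(|k|² + Cρ)` for positive torus minimisers). This file is the first of the
refuter's negative-side chain (`PairCorrelationToolkit` → `AntiCorrelatedWitness` →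
`PuffFloorFalseWithoutMinimality` → `PuffFloorFalseForNearMinimisers`), which proves that the
minimality hypothesis of the crux is load-bearing and cannot be weakened to near-minimality.

Contents (all `[folklore]`, over `cellWave` / `planeWaveSum` / `integral_cellN_prod_cellWave` of
the Literature torus layer):

* word products of plane waves (`prod_cellWave_add/neg/single`, `pairWave_eq_prod`) and the cell
  integrals `∫_{Λᴺ} e_m(xᵢ)ē_m(xⱼ) = 0` (`i ≠ j`, `m ≠ 0`) and
  `∫_{Λᴺ} (e_m(xᵢ)ē_m(xⱼ))(e_m(x_a)ē_m(x_b)) = [i = b ∧ a = j] L^{3N}`;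
* the pair-correlation polynomial `T_m = ∑_{i≠j} e_m(xᵢ)ē_m(xⱼ)` (`pairSum`) with `∫ T_m = 0`,
  `∫ T_m² = #offDiag · L^{3N} = N(N-1)L^{3N}`, and `|ρ_m|² = N + T_m` (`normSq_planeWaveSum`);
* its real form `t_m = |ρ_m|² - N` (`pairCorr`): bounds `-N ≤ t_m ≤ N² - N`, `C¹`, periodic,
  Bose-symmetric, `∫ t_m = 0`, `∫ t_m² = N(N-1)(L³)ᴺ`.

No statement of the route is asserted here.
-/

noncomputable section

namespace Summit.AtomisticToContinuum.BoseEinsteinCondensation.Theorems.PuffFloor.Negative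

open Literature.MathematicalPhysics.QuantumManyBody.BoseGas MeasureTheory Complex Finset
open scoped ComplexConjugate BigOperators ENNReal NNReal

variable {N : ℕ} {L : ℝ}

/-! ### Word products of plane waves and their cell integrals -/

/-- `∏ₗ e_{(w+w')ₗ}(xₗ) = ∏ₗ e_{wₗ}(xₗ) · ∏ₗ e_{w'ₗ}(xₗ)`. [folklore] -/
theorem prod_cellWave_add (w w' : Fin N → (Fin 3 → ℤ)) (X : Config N) :
    ∏ l, cellWave L ((w + w') l) (X l) =
      (∏ l, cellWave L (w l) (X l)) * ∏ l, cellWave L (w' l) (X l) := by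
  rw [← Finset.prod_mul_distrib]
  refine Finset.prod_congr rfl fun l _ => ?_
  rw [Pi.add_apply, cellWave_add_index]

/-- `∏ₗ e_{-wₗ}(xₗ) = conj ∏ₗ e_{wₗ}(xₗ)`. [folklore] -/
theorem prod_cellWave_neg (w : Fin N → (Fin 3 → ℤ)) (X : Config N) :
    ∏ l, cellWave L ((-w) l) (X l) = conj (∏ l, cellWave L (w l) (X l)) := by
  rw [map_prod]
  refine Finset.prod_congr rfl fun l _ => ?_
  rw [Pi.neg_apply, conj_cellWave]

/-- `∏ₗ e_{(δᵢm)ₗ}(xₗ) = e_m(xᵢ)`. [folklore] -/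
theorem prod_cellWave_single (i : Fin N) (m : Fin 3 → ℤ) (X : Config N) :
    ∏ l, cellWave L ((Pi.single i m : Fin N → (Fin 3 → ℤ)) l) (X l) = cellWave L m (X i) := by
  rw [Finset.prod_eq_single i]
  · rw [Pi.single_eq_same]
  · intro l _ hl; rw [Pi.single_eq_of_ne hl, cellWave_zero]
  · intro h; exact absurd (Finset.mem_univ i) h

/-- The pair wave `e_m(xᵢ) conj e_m(xⱼ)` is the word product of `δᵢ m - δⱼ m`. [folklore] -/
theorem pairWave_eq_prod (i j : Fin N) (m : Fin 3 → ℤ) (X : Config N) :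
    cellWave L m (X i) * conj (cellWave L m (X j)) =
      ∏ l, cellWave L ((Pi.single i m - Pi.single j m : Fin N → (Fin 3 → ℤ)) l) (X l) := by
  rw [sub_eq_add_neg, prod_cellWave_add, prod_cellWave_neg, prod_cellWave_single,
    prod_cellWave_single]

/-- `∫_{Λᴺ} e_m(xᵢ) conj e_m(xⱼ) dX = 0` for `i ≠ j`, `m ≠ 0`. [folklore] -/
theorem integral_cellN_pairWave (hL : 0 < L) {m : Fin 3 → ℤ} (hm : m ≠ 0) {i j : Fin N}
    (hij : i ≠ j) :
    ∫ X in cellN N L, cellWave L m (X i) * conj (cellWave L m (X j)) = 0 := by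
  simp_rw [pairWave_eq_prod]
  rw [integral_cellN_prod_cellWave hL, if_neg]
  intro h
  have h' := congr_fun h i
  rw [Pi.sub_apply, Pi.single_eq_same, Pi.single_eq_of_ne hij, sub_zero, Pi.zero_apply] at h'
  exact hm h'

/-- `∫_{Λᴺ} (e_m(xᵢ)ē_m(xⱼ))(e_m(x_a)ē_m(x_b)) dX = [i = b ∧ a = j] L^{3N}` (`i ≠ j`, `m ≠ 0`,
so `2m ≠ 0`: the word `δᵢ+δ_a-δⱼ-δ_b` vanishes iff `{i,a} = {j,b}`). [folklore] -/
theorem integral_cellN_pairWave_mul_pairWave (hL : 0 < L) {m : Fin 3 → ℤ} (hm : m ≠ 0)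
    {i j : Fin N} (hij : i ≠ j) (a b : Fin N) :
    ∫ X in cellN N L, (cellWave L m (X i) * conj (cellWave L m (X j))) *
        (cellWave L m (X a) * conj (cellWave L m (X b))) =
      if i = b ∧ a = j then ((L : ℂ) ^ 3) ^ N else 0 := by
  simp_rw [pairWave_eq_prod, ← prod_cellWave_add]
  rw [integral_cellN_prod_cellWave hL]
  have hmm : m + m ≠ 0 := by
    intro h
    apply hm
    have h2 : (2 : ℤ) • m = 0 := by rw [two_smul]; exact h
    exact (smul_eq_zero.1 h2).resolve_left (by norm_num)
  have key : (Pi.single i m - Pi.single j m + (Pi.single a m - Pi.single b m) :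
      Fin N → (Fin 3 → ℤ)) = 0 ↔ (i = b ∧ a = j) := by
    rw [show (Pi.single i m - Pi.single j m + (Pi.single a m - Pi.single b m) :
        Fin N → (Fin 3 → ℤ)) = (Pi.single i m + Pi.single a m) - (Pi.single j m + Pi.single b m)
        by abel, sub_eq_zero, Pi.single_add_single_eq_single_add_single hm hm]
    constructor
    · rintro (⟨rfl, -⟩ | ⟨-, h1, h2⟩ | ⟨h, -, -⟩)
      · exact absurd rfl hij
      · exact ⟨h1, h2⟩
      · exact absurd h hmm
    · rintro ⟨h1, h2⟩
      exact Or.inr (Or.inl ⟨rfl, h1, h2⟩)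
  by_cases h : i = b ∧ a = j
  · rw [if_pos (key.2 h), if_pos h]
  · rw [if_neg (fun h' => h (key.1 h')), if_neg h]

/-! ### The pair-correlation polynomial `T_m = |ρ_m|² - N` -/

/-- `T_m(X) = ∑_{i ≠ j} e_m(xᵢ) conj e_m(xⱼ)` (`= |∑ⱼ e_m(xⱼ)|² - N`). [folklore] -/
def pairSum (L : ℝ) (m : Fin 3 → ℤ) (X : Config N) : ℂ :=
  ∑ p ∈ (Finset.univ : Finset (Fin N)).offDiag,
    cellWave L m (X p.1) * conj (cellWave L m (X p.2))

/-- Pair waves are continuous. [folklore] -/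
theorem continuous_pairWave (L : ℝ) (m : Fin 3 → ℤ) (i j : Fin N) :
    Continuous fun X : Config N => cellWave L m (X i) * conj (cellWave L m (X j)) :=
  ((continuous_cellWave L m).comp (continuous_apply i)).mul
    (Complex.continuous_conj.comp ((continuous_cellWave L m).comp (continuous_apply j)))

/-- Pair waves have modulus `1`. [folklore] -/
theorem norm_pairWave (L : ℝ) (m : Fin 3 → ℤ) (i j : Fin N) (X : Config N) :
    ‖cellWave L m (X i) * conj (cellWave L m (X j))‖ = 1 := by
  rw [norm_mul, Complex.norm_conj, norm_cellWave, norm_cellWave, mul_one]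

/-- `∫_{Λᴺ} T_m = 0` (`m ≠ 0`). [folklore] -/
theorem integral_cellN_pairSum (hL : 0 < L) {m : Fin 3 → ℤ} (hm : m ≠ 0) :
    ∫ X in cellN N L, pairSum L m X = 0 := by
  unfold pairSum
  rw [integral_finsetSum _ fun p _ => integrableOn_cellN_of_bounded L
    (continuous_pairWave L m p.1 p.2) (fun X => (norm_pairWave L m p.1 p.2 X).le)]
  refine Finset.sum_eq_zero fun p hp => ?_
  exact integral_cellN_pairWave hL hm (Finset.mem_offDiag.1 hp).2.2

/-- `∫_{Λᴺ} T_m² = #offDiag · L^{3N} = N(N-1) L^{3N}` (`m ≠ 0`). [folklore] -/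
theorem integral_cellN_pairSum_sq (hL : 0 < L) {m : Fin 3 → ℤ} (hm : m ≠ 0) :
    ∫ X in cellN N L, pairSum L m X ^ 2 =
      ((Finset.univ : Finset (Fin N)).offDiag.card : ℂ) * ((L : ℂ) ^ 3) ^ N := by
  have hexp : ∀ X : Config N, pairSum L m X ^ 2 =
      ∑ p ∈ (Finset.univ : Finset (Fin N)).offDiag, ∑ q ∈ (Finset.univ : Finset (Fin N)).offDiag,
        (cellWave L m (X p.1) * conj (cellWave L m (X p.2))) *
          (cellWave L m (X q.1) * conj (cellWave L m (X q.2))) := by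
    intro X
    rw [sq, pairSum, Finset.sum_mul_sum]
  simp_rw [hexp]
  have hint : ∀ p q : Fin N × Fin N, IntegrableOn (fun X : Config N =>
      (cellWave L m (X p.1) * conj (cellWave L m (X p.2))) *
        (cellWave L m (X q.1) * conj (cellWave L m (X q.2)))) (cellN N L) := by
    intro p q
    refine integrableOn_cellN_of_bounded L ((continuous_pairWave L m p.1 p.2).mul
      (continuous_pairWave L m q.1 q.2)) (M := 1) fun X => ?_
    rw [norm_mul, norm_pairWave, norm_pairWave, mul_one]
  rw [integral_finsetSum _ fun p _ => integrable_finsetSum _ fun q _ => hint p q]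
  simp_rw [integral_finsetSum _ fun q _ => hint _ q]
  have hinner : ∀ p ∈ (Finset.univ : Finset (Fin N)).offDiag,
      ∑ q ∈ (Finset.univ : Finset (Fin N)).offDiag,
        ∫ X in cellN N L, (cellWave L m (X p.1) * conj (cellWave L m (X p.2))) *
          (cellWave L m (X q.1) * conj (cellWave L m (X q.2))) = ((L : ℂ) ^ 3) ^ N := by
    intro p hp
    have hp' := (Finset.mem_offDiag.1 hp).2.2
    simp_rw [integral_cellN_pairWave_mul_pairWave hL hm hp']
    have hiff : ∀ q : Fin N × Fin N, (p.1 = q.2 ∧ q.1 = p.2) ↔ q = p.swap := by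
      rintro ⟨q1, q2⟩
      simp only [Prod.swap, Prod.mk.injEq]
      constructor
      · rintro ⟨h1, h2⟩; exact ⟨h2, h1.symm⟩
      · rintro ⟨h1, h2⟩; exact ⟨h2.symm, h1⟩
    simp_rw [hiff]
    rw [Finset.sum_ite_eq']
    rw [if_pos]
    rw [Finset.mem_offDiag]
    exact ⟨Finset.mem_univ _, Finset.mem_univ _, fun h => hp' h.symm⟩
  rw [Finset.sum_congr rfl hinner, Finset.sum_const, nsmul_eq_mul]

/-- `#offDiag(Fin N) = N(N-1)` as a real number. [folklore] -/
theorem card_offDiag_fin (N : ℕ) :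
    (((Finset.univ : Finset (Fin N)).offDiag.card : ℕ) : ℝ) = (N : ℝ) * ((N : ℝ) - 1) := by
  rw [Finset.offDiag_card, Finset.card_univ, Fintype.card_fin,
    Nat.cast_sub (Nat.le_mul_self N), Nat.cast_mul]
  ring

/-- `|ρ_m(X)|² = N + T_m(X)` with `ρ_m = planeWaveSum`. [folklore] -/
theorem normSq_planeWaveSum (L : ℝ) (m : Fin 3 → ℤ) (X : Config N) :
    ((‖planeWaveSum L m X‖ ^ 2 : ℝ) : ℂ) = (N : ℂ) + pairSum L m X := by
  rw [Complex.ofReal_pow, ← Complex.mul_conj', planeWaveSum, map_sum, Finset.sum_mul_sum, ← Finset.sum_product',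
    ← Finset.diag_union_offDiag, Finset.sum_union (Finset.disjoint_diag_offDiag _),
    Finset.sum_diag, pairSum]
  congr 1
  simp [Complex.mul_conj', norm_cellWave]


/-! ### Real form of the pair-correlation polynomial -/

/-- `t_m(X) = |ρ_m(X)|² - N`, the real form of `T_m` (`ρ_m = planeWaveSum`). [folklore] -/
def pairCorr (L : ℝ) (m : Fin 3 → ℤ) (X : Config N) : ℝ :=
  ‖planeWaveSum L m X‖ ^ 2 - N

/-- `t_m = T_m` (the pair sum is real). [folklore] -/
theorem ofReal_pairCorr (L : ℝ) (m : Fin 3 → ℤ) (X : Config N) :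
    ((pairCorr L m X : ℝ) : ℂ) = pairSum L m X := by
  rw [pairCorr, Complex.ofReal_sub, normSq_planeWaveSum]
  push_cast
  ring

/-- `t_m ≤ N² - N` (`|ρ_m| ≤ N`). [folklore] -/
theorem pairCorr_le (L : ℝ) (m : Fin 3 → ℤ) (X : Config N) :
    pairCorr L m X ≤ (N : ℝ) ^ 2 - N := by
  unfold pairCorr
  have h := norm_planeWaveSum_le L m X
  have h0 := norm_nonneg (planeWaveSum L m X)
  nlinarith

/-- `-N ≤ t_m`. [folklore] -/
theorem neg_le_pairCorr (L : ℝ) (m : Fin 3 → ℤ) (X : Config N) : -(N : ℝ) ≤ pairCorr L m X := by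
  unfold pairCorr
  nlinarith [sq_nonneg ‖planeWaveSum L m X‖]

/-- `t_m` is `C¹`. [folklore] -/
theorem contDiff_pairCorr (L : ℝ) (m : Fin 3 → ℤ) : ContDiff ℝ 1 (pairCorr (N := N) L m) :=
  (ContDiff.norm_sq (𝕜 := ℂ) (contDiff_planeWaveSum L m)).sub contDiff_const

/-- `t_m` is continuous. [folklore] -/
theorem continuous_pairCorr (L : ℝ) (m : Fin 3 → ℤ) : Continuous (pairCorr (N := N) L m) :=
  (contDiff_pairCorr L m).continuous

/-- `t_m` is `Lℤ³`-periodic in each particle. [folklore] -/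
theorem pairCorr_periodic (hL : L ≠ 0) (m : Fin 3 → ℤ) (X : Config N) (i : Fin N) (a : Fin 3) :
    pairCorr L m (X + Pi.single i (EuclideanSpace.single a L)) = pairCorr L m X := by
  unfold pairCorr
  rw [planeWaveSum_periodic hL]

/-- `t_m` is Bose-symmetric. [folklore] -/
theorem pairCorr_symm (L : ℝ) (m : Fin 3 → ℤ) (σ : Equiv.Perm (Fin N)) (X : Config N) :
    pairCorr L m (X ∘ σ) = pairCorr L m X := by
  unfold pairCorr
  rw [planeWaveSum_symm]

/-- Continuous real functions are integrable on the cell. [folklore] -/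
theorem integrableOn_cellN_real (L : ℝ) {f : Config N → ℝ} (hf : Continuous f) :
    IntegrableOn f (cellN N L) volume :=
  (hf.continuousOn.integrableOn_compact (isCompact_closedBoxN N L)).mono_set
    (cellN_subset_closedBoxN N L)

/-- `∫_{Λᴺ} t_m = 0`. [folklore] -/
theorem integral_cellN_pairCorr (hL : 0 < L) {m : Fin 3 → ℤ} (hm : m ≠ 0) :
    ∫ X in cellN N L, pairCorr L m X = 0 := by
  have h : ((∫ X in cellN N L, pairCorr L m X : ℝ) : ℂ) = 0 := by
    rw [← integral_complex_ofReal]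
    simp_rw [ofReal_pairCorr]
    exact integral_cellN_pairSum hL hm
  exact_mod_cast h

/-- `∫_{Λᴺ} t_m² = N(N-1) L^{3N}`. [folklore] -/
theorem integral_cellN_pairCorr_sq (hL : 0 < L) {m : Fin 3 → ℤ} (hm : m ≠ 0) :
    ∫ X in cellN N L, pairCorr L m X ^ 2 = (N : ℝ) * ((N : ℝ) - 1) * (L ^ 3) ^ N := by
  have h : ((∫ X in cellN N L, pairCorr L m X ^ 2 : ℝ) : ℂ) =
      (((N : ℝ) * ((N : ℝ) - 1) * (L ^ 3) ^ N : ℝ) : ℂ) := by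
    rw [← integral_complex_ofReal]
    push_cast
    simp_rw [ofReal_pairCorr]
    rw [integral_cellN_pairSum_sq hL hm]
    have hc : (((Finset.univ : Finset (Fin N)).offDiag.card : ℕ) : ℂ) =
        ((((Finset.univ : Finset (Fin N)).offDiag.card : ℕ) : ℝ) : ℂ) := by norm_cast
    rw [hc, card_offDiag_fin N]
    push_cast
    ring
  exact_mod_cast h

end Summit.AtomisticToContinuum.BoseEinsteinCondensation.Theorems.PuffFloor.Negative

end
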